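import Literature.AnabelianGeometry.SemiGraphs.TemperedQuasiGeometricCompatibleProofs
import Literature.AnabelianGeometry.SemiGraphs.TemperedReconstructionReductionsProofsAt
import Literature.AnabelianGeometry.SemiGraphs.TemperedCompactInVerticialFinite
import HarnessLib

/-!
# Definition 3.8, compatible reading: INJECTIVE quasi-geometric homomorphisms are compatibly
# quasi-geometric — AT ONE GRAPH / ONE PAIR OF GRAPHS (φ2 twin of `TemperedQuasiGeometricCompatibleProofs`, proof-only)

Mochizuki, *Semi-graphs of anabelioids*, Publ. RIMS **42** (2006), §3, Def. 3.8 / Cor. 3.9 p. 42,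
Thm. 3.7 (ii), (iv) pp. 40–41 [cite: MochizukiSemiAnbd2006, Def 3.8 p.42].

PROOF-ONLY companion (cell abc-iut, layer L3, L3-lead α107/α108 «CIV-REBIND-L3·MCIV», seat
abc-iut-w6-d120; label [mechanical rebind after p442260/p443103; not a cone member]) of
`TemperedQuasiGeometricCompatibleProofs.lean`: the two declarations there that consume the ∀-countable
named fact Thm 3.7 (iv) `MaximalCompactIffVerticial` (FACT-LIST F-1750, whose ∀-countable reading is
refuted in the kernel at universe `0`, `ProfiniteSemiGraph.not_maximalCompactIffVerticial`) —
`isCompatiblyQuasiGeometric_of_injective` and `isCompatiblyQuasiGeometric_of_compat_of_injective` —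
re-proved VERBATIM with abc-iut-w4-d075's per-graph predicate `MaximalCompactIffVerticialAt`
(`TemperedCompactInVerticialAt.lean`) at the graphs where the original instantiates it: Thm 3.7 (iv) at
the SOURCE `𝒢` only for the first (`(h37iv : MaximalCompactIffVerticialAt 𝒢)`), at `𝒢` and at `ℋ` for
the second (through abc-iut-L3-d1's per-pair R0 `InducedIsQuasiGeometric_of_at`).  Port rule (α4-3):
`h37iv 𝒢 h𝒢 c𝒢 ↦ h37iv h𝒢 c𝒢`, decl suffix `At`; the (iv)-free lemma of the original
(`relIndex_eq_zero_of_verticial_ne`, Thm 3.7 (ii) PROVED as `verticialDistinct_holds`) is reused via the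
import; original untouched.

Then the per-graph binders are DISCHARGED where print proves them: from Thm 3.7 (iii) at the graph
(`…_of_compactInVerticialAt…`, via abc-iut-L3-t11's `maximalCompactIffVerticialAt_of_compactInVerticialAt`)
and, hypothesis-free beyond print's, at FINITE semi-graphs (`…_of_finiteGraph`, via
`maximalCompactIffVerticialAt_of_finiteGraph`, print p. 41 "since the semi-graphs `𝔾_j` are all
finite"; Thm 3.7 (i) by `verticialInjective_holds`).  Nothing here asserts Thm 3.7 (iv) for an infinite
`𝔾`; nothing here takes a side on [IUTchIII] Cor. 3.12; typed ≠ discharged.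
-/

open Topology

namespace Literature.AnabelianGeometry.SemiGraphs

namespace ProfiniteSemiGraph

universe u

variable {𝒢 ℋ : ProfiniteSemiGraph.{u}}

/-! ### Thm 3.7 (iv) AT the source graph -/

/-- **Injective quasi-geometric homomorphisms are compatibly quasi-geometric, AT the graph `𝒢`** (φ2
twin of `isCompatiblyQuasiGeometric_of_injective`; Def. 3.8, compatible reading; the source a semi-graph
of anabelioids under the hypotheses of Thm. 3.7, with Thm. 3.7 (iv) AT `𝒢` as the binder): were two
distinct maximal compact `K₁ ≠ H₁` (verticial, Thm. 3.7 (iv) at `𝒢`) carried into ONE maximal compact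
`Q`, `φ(H₁)` would have finite index over `φ(K₁ ∩ H₁)`, contradicting Thm. 3.7 (ii) transported along the
injective `φ`. [cite: MochizukiSemiAnbd2006, Def 3.8 p.42] -/
theorem isCompatiblyQuasiGeometric_of_injectiveAt
    (h37iv : MaximalCompactIffVerticialAt 𝒢) (h𝒢 : 𝒢.Thm37Hypotheses) (c𝒢 : TemperedPiChart 𝒢)
    {Γ : Type u} [Group Γ] [TopologicalSpace Γ] [IsTopologicalGroup Γ] {φ : c𝒢.G →ₜ* Γ}
    (hq : IsQuasiGeometric φ) (hinj : Function.Injective φ) : IsCompatiblyQuasiGeometric φ := by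
  refine ⟨hq, fun K₁ H₁ hK₁ hH₁ hne hnt => ?_⟩
  obtain ⟨hmax, -⟩ := h37iv h𝒢 c𝒢
  obtain ⟨v₁, hK₁v⟩ := (hmax K₁).mp hK₁
  obtain ⟨v₂, hH₁v⟩ := (hmax H₁).mp hH₁
  obtain ⟨K₂, hK₂, hmK⟩ := hq.maximal K₁ hK₁
  obtain ⟨H₂, hH₂, hmH⟩ := hq.maximal H₁ hH₁
  by_cases h : K₂ = H₂
  · exfalso
    subst h
    -- source: infinite index; injectivity transports it
    have h1 : (H₁.map φ.toMonoidHom).relIndex (K₁.map φ.toMonoidHom) = 0 := by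
      rw [Subgroup.relIndex_map_map_of_injective _ _ hinj]
      exact relIndex_eq_zero_of_verticial_ne h𝒢 c𝒢 hK₁v hH₁v hne
    -- target: `φ(H₁)` has finite index in `K₂ ⊇ φ(K₁)`
    have h2 : (H₁.map φ.toMonoidHom).relIndex K₂ ≠ 0 :=
      relIndex_ne_zero_of_mapsOnto φ.toMonoidHom hK₂.1 hmH
    exact h2 (Subgroup.relIndex_eq_zero_of_le_right hmK.1 h1)
  · exact ⟨K₂, H₂, hK₂, hH₂, h, hmK.1, hmH.1⟩

/-- **An INJECTIVE homomorphism compatible with a locally open morphism is compatibly quasi-geometric, AT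
the pair `(𝒢, ℋ)`** (φ2 twin of `isCompatiblyQuasiGeometric_of_compat_of_injective`; Cor. 3.9 (a) over
the compatible reading, injective case): abc-iut-L3-d1's per-pair R0 `InducedIsQuasiGeometric_of_at`
(Thm. 3.7 (iv) at `𝒢` and at `ℋ`) gives the literal Def. 3.8, injectivity the compatibility (Thm. 3.7
(iv) at `𝒢`). [cite: MochizukiSemiAnbd2006, Cor 3.9 p.42] -/
theorem isCompatiblyQuasiGeometric_of_compat_of_injectiveAt (h37i : VerticialInjective.{u})
    (h37iv𝒢 : MaximalCompactIffVerticialAt 𝒢) (h37ivℋ : MaximalCompactIffVerticialAt ℋ)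
    (h𝒢 : Cor39Hypotheses 𝒢) (hℋ : Cor39Hypotheses ℋ) (c𝒢 : TemperedPiChart 𝒢)
    (cℋ : TemperedPiChart ℋ) (F : Hom 𝒢 ℋ) (φ : c𝒢.G →ₜ* cℋ.G) (hF : F.IsLocallyOpen)
    (hV : F.CompatV c𝒢 cℋ φ) (hE : F.CompatE c𝒢 cℋ φ) (hinj : Function.Injective φ) :
    IsCompatiblyQuasiGeometric φ :=
  isCompatiblyQuasiGeometric_of_injectiveAt h37iv𝒢 h𝒢.thm37Hypotheses c𝒢
    (InducedIsQuasiGeometric_of_at h37i h37iv𝒢 h37ivℋ h𝒢 hℋ c𝒢 cℋ F φ hF hV hE) hinj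

/-! ### From Thm 3.7 (iii) at the graph(s) ((i), (ii) discharged in the tree) -/

/-- **Injective quasi-geometric homomorphisms are compatibly quasi-geometric, from Thm 3.7 (iii) AT `𝒢`**
(Thm 3.7 (iv) at `𝒢` by abc-iut-L3-t11's `maximalCompactIffVerticialAt_of_compactInVerticialAt`).
[cite: MochizukiSemiAnbd2006, Def 3.8 p.42] -/
theorem isCompatiblyQuasiGeometric_of_compactInVerticialAt_of_injective
    (h37iii : CompactInVerticialAt 𝒢) (h𝒢 : 𝒢.Thm37Hypotheses) (c𝒢 : TemperedPiChart 𝒢)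
    {Γ : Type u} [Group Γ] [TopologicalSpace Γ] [IsTopologicalGroup Γ] {φ : c𝒢.G →ₜ* Γ}
    (hq : IsQuasiGeometric φ) (hinj : Function.Injective φ) : IsCompatiblyQuasiGeometric φ :=
  isCompatiblyQuasiGeometric_of_injectiveAt (maximalCompactIffVerticialAt_of_compactInVerticialAt h37iii)
    h𝒢 c𝒢 hq hinj

/-- **An injective homomorphism compatible with a locally open morphism is compatibly quasi-geometric,
from Thm 3.7 (iii) AT `𝒢` and AT `ℋ`** (Thm 3.7 (i) by `verticialInjective_holds`).
[cite: MochizukiSemiAnbd2006, Cor 3.9 p.42] -/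
theorem isCompatiblyQuasiGeometric_of_compat_of_injective_of_compactInVerticialAt
    (h𝒢iii : CompactInVerticialAt 𝒢) (hℋiii : CompactInVerticialAt ℋ)
    (h𝒢 : Cor39Hypotheses 𝒢) (hℋ : Cor39Hypotheses ℋ) (c𝒢 : TemperedPiChart 𝒢)
    (cℋ : TemperedPiChart ℋ) (F : Hom 𝒢 ℋ) (φ : c𝒢.G →ₜ* cℋ.G) (hF : F.IsLocallyOpen)
    (hV : F.CompatV c𝒢 cℋ φ) (hE : F.CompatE c𝒢 cℋ φ) (hinj : Function.Injective φ) :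
    IsCompatiblyQuasiGeometric φ :=
  isCompatiblyQuasiGeometric_of_compat_of_injectiveAt verticialInjective_holds
    (maximalCompactIffVerticialAt_of_compactInVerticialAt h𝒢iii)
    (maximalCompactIffVerticialAt_of_compactInVerticialAt hℋiii) h𝒢 hℋ c𝒢 cℋ F φ hF hV hE hinj

/-! ### Discharged at FINITE semi-graphs (print p. 41: "the semi-graphs `𝔾_j` are all finite") -/

/-- **At a FINITE `𝔾`, injective quasi-geometric homomorphisms out of `π₁^temp(𝒢)` are compatibly
quasi-geometric** — no binder beyond the hypotheses of Thm. 3.7 (Thm 3.7 (iv) at `𝒢` is the kernel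
theorem `maximalCompactIffVerticialAt_of_finiteGraph`). [cite: MochizukiSemiAnbd2006, Def 3.8 p.42] -/
theorem isCompatiblyQuasiGeometric_of_injective_of_finiteGraph [Finite 𝒢.graph.Vertex]
    [Finite 𝒢.graph.Edge] (h𝒢 : 𝒢.Thm37Hypotheses) (c𝒢 : TemperedPiChart 𝒢)
    {Γ : Type u} [Group Γ] [TopologicalSpace Γ] [IsTopologicalGroup Γ] {φ : c𝒢.G →ₜ* Γ}
    (hq : IsQuasiGeometric φ) (hinj : Function.Injective φ) : IsCompatiblyQuasiGeometric φ :=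
  isCompatiblyQuasiGeometric_of_injectiveAt maximalCompactIffVerticialAt_of_finiteGraph h𝒢 c𝒢 hq hinj

/-- The same with explicit finiteness hypotheses. [cite: MochizukiSemiAnbd2006, Def 3.8 p.42] -/
theorem isCompatiblyQuasiGeometric_of_injective_of_finiteGraph' (hV : Finite 𝒢.graph.Vertex)
    (hE : Finite 𝒢.graph.Edge) (h𝒢 : 𝒢.Thm37Hypotheses) (c𝒢 : TemperedPiChart 𝒢)
    {Γ : Type u} [Group Γ] [TopologicalSpace Γ] [IsTopologicalGroup Γ] {φ : c𝒢.G →ₜ* Γ}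
    (hq : IsQuasiGeometric φ) (hinj : Function.Injective φ) : IsCompatiblyQuasiGeometric φ :=
  isCompatiblyQuasiGeometric_of_injective_of_finiteGraph h𝒢 c𝒢 hq hinj

/-- **At a pair of FINITE graphs `𝔾`, `ℍ`, an injective homomorphism compatible with a locally open
morphism `G → H` is compatibly quasi-geometric** (Cor. 3.9 (a), compatible reading, injective case) —
no binder beyond the hypotheses of Cor. 3.9 (Thm 3.7 (i) `verticialInjective_holds`, Thm 3.7 (iv) at
`𝒢`, `ℋ` by `maximalCompactIffVerticialAt_of_finiteGraph`). [cite: MochizukiSemiAnbd2006, Cor 3.9 p.42] -/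
theorem isCompatiblyQuasiGeometric_of_compat_of_injective_of_finiteGraph [Finite 𝒢.graph.Vertex]
    [Finite 𝒢.graph.Edge] [Finite ℋ.graph.Vertex] [Finite ℋ.graph.Edge]
    (h𝒢 : Cor39Hypotheses 𝒢) (hℋ : Cor39Hypotheses ℋ) (c𝒢 : TemperedPiChart 𝒢)
    (cℋ : TemperedPiChart ℋ) (F : Hom 𝒢 ℋ) (φ : c𝒢.G →ₜ* cℋ.G) (hF : F.IsLocallyOpen)
    (hV : F.CompatV c𝒢 cℋ φ) (hE : F.CompatE c𝒢 cℋ φ) (hinj : Function.Injective φ) :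
    IsCompatiblyQuasiGeometric φ :=
  isCompatiblyQuasiGeometric_of_compat_of_injectiveAt verticialInjective_holds
    maximalCompactIffVerticialAt_of_finiteGraph maximalCompactIffVerticialAt_of_finiteGraph
    h𝒢 hℋ c𝒢 cℋ F φ hF hV hE hinj

/-- The same with explicit finiteness hypotheses. [cite: MochizukiSemiAnbd2006, Cor 3.9 p.42] -/
theorem isCompatiblyQuasiGeometric_of_compat_of_injective_of_finiteGraph'
    (h𝒢V : Finite 𝒢.graph.Vertex) (h𝒢E : Finite 𝒢.graph.Edge) (hℋV : Finite ℋ.graph.Vertex)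
    (hℋE : Finite ℋ.graph.Edge) (h𝒢 : Cor39Hypotheses 𝒢) (hℋ : Cor39Hypotheses ℋ)
    (c𝒢 : TemperedPiChart 𝒢) (cℋ : TemperedPiChart ℋ) (F : Hom 𝒢 ℋ) (φ : c𝒢.G →ₜ* cℋ.G)
    (hF : F.IsLocallyOpen) (hV : F.CompatV c𝒢 cℋ φ) (hE : F.CompatE c𝒢 cℋ φ)
    (hinj : Function.Injective φ) : IsCompatiblyQuasiGeometric φ :=
  isCompatiblyQuasiGeometric_of_compat_of_injective_of_finiteGraph h𝒢 hℋ c𝒢 cℋ F φ hF hV hE hinj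

/-! ### Sanity links: the ∀-countable originals are the per-graph forms at every graph -/

/-- The frozen ∀-countable binder specialises to the per-graph one (sanity link to
`isCompatiblyQuasiGeometric_of_injective`; the ∀-form is kernel-false at universe `0`, so this direction
only records that the twin is not weaker). [cite: MochizukiSemiAnbd2006, Def 3.8 p.42] -/
theorem isCompatiblyQuasiGeometric_of_injective_of_forall_at
    (h37iv : ∀ 𝒢 : ProfiniteSemiGraph.{u}, MaximalCompactIffVerticialAt 𝒢) (h𝒢 : 𝒢.Thm37Hypotheses)
    (c𝒢 : TemperedPiChart 𝒢) {Γ : Type u} [Group Γ] [TopologicalSpace Γ] [IsTopologicalGroup Γ]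
    {φ : c𝒢.G →ₜ* Γ} (hq : IsQuasiGeometric φ) (hinj : Function.Injective φ) :
    IsCompatiblyQuasiGeometric φ :=
  isCompatiblyQuasiGeometric_of_injectiveAt (h37iv 𝒢) h𝒢 c𝒢 hq hinj

end ProfiniteSemiGraph

end Literature.AnabelianGeometry.SemiGraphs
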